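import Mathlib
import Summits.AtomisticToContinuum.HydrodynamicLimit.Theorems.ImplosionDichotomyDenseExcursionPackingResolventInnerPoint
import Summits.AtomisticToContinuum.HydrodynamicLimit.Theorems.ImplosionDichotomyDenseExcursionPackingResolventInnerTouch
import Literature.Analysis.ODE.BarrierTouching

/-!
# The inner region of the packing-resolvent gain: the two touching cases `U` and `Z`
# (crux `DenseExcursion`, stmt-AtomisticToContinuum-12586, line `sonic-cavity-renewal` v8, stub `stub_packingResolventW`)

Helper file (`--supports stmt-AtomisticToContinuum-12586`) for the registered stub `stub_packingResolventW` (skeleton v8;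
registered helper here: `packingResolventW_lamBound`). THE ANALYTIC HALF OF THE INNER REGION `x ≤ x_Λ` of the barrier
a-priori estimate. Unknowns: `U = u₁ − λΨ`, `Z = V − H − λΦ`, where `V = Λe^{2x}Su₂/s₀²`, `H = ∫_{x_Λ} h₂` (landed
`packingResolventW_innerPrimitive`), `Φ = φ(ρ(x))`, `Ψ = ψ(ρ(x))`, `ρ = (Λ/s₀)eˣ ≤ 2`, the modified-Bessel comparison
polynomials (landed `besselPhi5_comp_hasDerivAt`, …), and `λφ(2) = V(x_Λ)` — so that `Z(x_Λ) = 0` and the growing centre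
mode carried by the incoming datum is subtracted EXACTLY up to `O(1/Λ)` residuals. Barriers `Ū = 9Ne^{−ε(x−x_Λ)}`,
`Z̄ = (17/10)N(4.01 − ρ²)e^{−ε(x−x_Λ)}`. Given a number `θ ≥ 0` dominating the four gauges (`|U| ≤ θŪ`, `|Z| ≤ θZ̄` on
`x ≤ x_Λ`, `|P| + |M| ≤ θ(P̄ + M̄)` at `x_Λ`), this file proves: if `|U|/Ū` or `|Z|/Z̄` ATTAINS `θ` at some `x⋆ ≤ x_Λ` then
`θ ≤ 1` (`inner_cases`) — by the touching lemma `Literature.Analysis.ODE.barrier_touching'` (the `U`-equation has speed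
`−1`, outflow at `x_Λ`; the `Z`-equation speed `+1`, datum `Z(x_Λ) = 0`), the pointwise normal form
`packingResolventW_innerPoint` and the landed arithmetic closures `inner_U_touch`, `inner_Z_touch`; the size of the matching
constant, `|λ| ≤ 16.2θN`, is `packingResolventW_lamBound`.
-/

noncomputable section

open Set

namespace Summit.AtomisticToContinuum.HydrodynamicLimit.Theorems.PackingAnalyticImplosion

/-- **Registered helper `packingResolventW_lamBound` of `stub_packingResolventW`: THE SIZE OF THE MATCHING CONSTANT.**
At the interface (`eΛ = 2s₀`, `s̃ = Se ∈ [7/10, 1]`, `|s̃ − s₀| ≤ δ²`): `λφ(2)·s₀² = Λe²S(P − M)/6` and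
`|P| + |M| ≤ θ((N/Λ)(4 + 175S) + 2ηe)`, `η ≤ N`, give `|λ| ≤ 16.2θN` (`2s̃/s₀ ≈ 2`, `175S/Λ ≈ 87.5`, `/6`, `/φ(2) = /1.8134`).
[folklore] -/
theorem packingResolventW_lamBound : ∀ (Λ δ s₀ N η θ e Sv Pv Mv lam : ℝ), δ * Λ = 1 → 0 < δ → δ ≤ 1 / 1000 → 7 / 10 ≤ s₀ → s₀ ≤ 1 → e * Λ = 2 * s₀ → 7 / 10 ≤ Sv * e → Sv * e ≤ 1 → |Sv * e - s₀| ≤ δ ^ 2 → 0 < N → 0 ≤ η → η ≤ N → 0 ≤ θ → |Pv| + |Mv| ≤ θ * (N / Λ * (4 + 175 * Sv) + 2 * (η * e)) → lam * (94253 / 51975) = Λ * e ^ 2 * Sv * ((Pv - Mv) / 6) / s₀ ^ 2 → |lam| ≤ θ * (162 / 10) * N ∧ |lam| * (94253 / 51975) ≤ θ * (2918 / 100) * N := by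
  intro Λ δ s₀ N η θ e Sv Pv Mv lam hδΛ hδ hδ' hs₀ hs₀' heΛ hst1 hst2 hst0 hN hη hηN hθ hPM hlam
  have hΛ : 1000 ≤ Λ := thousand_le_of_delta hδΛ hδ hδ'
  have hΛpos : 0 < Λ := by linarith
  have hs0 : 0 < s₀ := by linarith
  have he : 0 < e := by
    by_contra hcon; push Not at hcon
    have : e * Λ ≤ 0 := mul_nonpos_of_nonpos_of_nonneg hcon hΛpos.le
    linarith
  obtain ⟨hsl, hsu⟩ := abs_le.1 hst0
  have hδ2 : δ ^ 2 ≤ 1 / 1000000 := by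
    calc δ ^ 2 ≤ (1 / 1000) ^ 2 := pow_le_pow_left₀ hδ.le hδ' 2
      _ = 1 / 1000000 := by norm_num
  have he2 : e ≤ 2 * δ := by
    -- `e = e (δ Λ) = δ (e Λ) = 2 s₀ δ ≤ 2 δ`
    have h1 : e = 2 * s₀ * δ := by
      calc e = e * (δ * Λ) := by rw [hδΛ, mul_one]
        _ = δ * (e * Λ) := by ring
        _ = 2 * s₀ * δ := by rw [heΛ]; ring
    rw [h1]; nlinarith only [hs₀', hδ, hs0]
  -- name `st = Sv e`
  obtain ⟨st, hst⟩ : ∃ st : ℝ, Sv * e = st := ⟨_, rfl⟩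
  rw [hst] at hst1 hst2 hsl hsu
  -- (1) `λ φ(2) s₀ = st (Pv − Mv)/3`
  have h1 : lam * (94253 / 51975) * s₀ = st * (Pv - Mv) / 3 := by
    have h2 : lam * (94253 / 51975) * s₀ ^ 2 = Λ * e ^ 2 * Sv * ((Pv - Mv) / 6) := by rw [hlam]; field_simp
    have h3 : Λ * e ^ 2 * Sv = 2 * s₀ * st := by
      calc Λ * e ^ 2 * Sv = (e * Λ) * (Sv * e) := by ring
        _ = 2 * s₀ * st := by rw [heΛ, hst]
    rw [h3] at h2
    have h4 : (lam * (94253 / 51975) * s₀ - st * (Pv - Mv) / 3) * s₀ = 0 := by linear_combination h2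
    rcases mul_eq_zero.1 h4 with h5 | h5
    · linarith
    · exact absurd h5 hs0.ne'
  -- (2) the datum multiplied by `e Λ = 2 s₀`: `X (2 s₀) = N (4 e + 175 st) + 4 η e s₀`
  have hX : (N / Λ * (4 + 175 * Sv) + 2 * (η * e)) * (2 * s₀) = N * (4 * e + 175 * st) + 4 * (η * e) * s₀ := by
    have h2 : N / Λ * (2 * s₀) = N * e := by rw [← heΛ]; field_simp
    calc (N / Λ * (4 + 175 * Sv) + 2 * (η * e)) * (2 * s₀) = N / Λ * (2 * s₀) * (4 + 175 * Sv) + 4 * (η * e) * s₀ := by ring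
      _ = N * e * (4 + 175 * Sv) + 4 * (η * e) * s₀ := by rw [h2]
      _ = N * (4 * e + 175 * (Sv * e)) + 4 * (η * e) * s₀ := by ring
      _ = _ := by rw [hst]
  -- (3) `|λ| φ(2) s₀ (2 s₀) ≤ θ st (N(4e + 175 st) + 4 η e s₀)/3`
  have h3 : |lam| * (94253 / 51975) * s₀ * (2 * s₀) ≤ θ * (st * (N * (4 * e + 175 * st) + 4 * (η * e) * s₀)) / 3 := by
    have h4 : |lam| * (94253 / 51975) * s₀ = st * |Pv - Mv| / 3 := by
      have := congrArg (fun t => |t|) h1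
      rw [abs_mul, abs_mul, abs_of_pos (by norm_num : (0:ℝ) < 94253 / 51975), abs_of_pos hs0, abs_div, abs_mul,
        abs_of_pos (by linarith : (0:ℝ) < st), abs_of_pos (by norm_num : (0:ℝ) < 3)] at this
      exact this
    rw [h4]
    have h5 : |Pv - Mv| ≤ θ * (N / Λ * (4 + 175 * Sv) + 2 * (η * e)) := (abs_sub _ _).trans hPM
    have h6 : |Pv - Mv| * (2 * s₀) ≤ θ * (N * (4 * e + 175 * st) + 4 * (η * e) * s₀) := by
      calc |Pv - Mv| * (2 * s₀) ≤ θ * (N / Λ * (4 + 175 * Sv) + 2 * (η * e)) * (2 * s₀) :=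
            mul_le_mul_of_nonneg_right h5 (by linarith)
        _ = θ * ((N / Λ * (4 + 175 * Sv) + 2 * (η * e)) * (2 * s₀)) := by ring
        _ = _ := by rw [hX]
    have h7 : st * (|Pv - Mv| * (2 * s₀)) ≤ st * (θ * (N * (4 * e + 175 * st) + 4 * (η * e) * s₀)) :=
      mul_le_mul_of_nonneg_left h6 (by linarith)
    have e1 : st * |Pv - Mv| / 3 * (2 * s₀) = st * (|Pv - Mv| * (2 * s₀)) / 3 := by ring
    have e2 : θ * (st * (N * (4 * e + 175 * st) + 4 * (η * e) * s₀)) / 3 = st * (θ * (N * (4 * e + 175 * st) + 4 * (η * e) * s₀)) / 3 := by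
      ring
    rw [e1, e2]
    exact div_le_div_of_nonneg_right h7 (by norm_num)
  -- (4) the bracket: `st (N(4e + 175 st) + 4 η e s₀) ≤ N (175 s₀² + 1/50)`
  have hbr : st * (N * (4 * e + 175 * st) + 4 * (η * e) * s₀) ≤ N * (175 * s₀ ^ 2 + 170 / 10000) := by
    have hηe : η * e ≤ N * (2 * δ) := mul_le_mul hηN he2 he.le hN.le
    have h4 : N * (4 * e + 175 * st) + 4 * (η * e) * s₀ ≤ N * (175 * st + 16 * δ) := by
      have h41 : 4 * (η * e) * s₀ ≤ 4 * (η * e) * 1 := by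
        apply mul_le_mul_of_nonneg_left hs₀'; positivity
      have h42 : N * e ≤ N * (2 * δ) := mul_le_mul_of_nonneg_left he2 hN.le
      linarith
    have h5 : st * (N * (4 * e + 175 * st) + 4 * (η * e) * s₀) ≤ (s₀ + δ ^ 2) * (N * (175 * (s₀ + δ ^ 2) + 16 * δ)) := by
      apply mul_le_mul (by linarith) (h4.trans _) (by positivity) (by positivity)
      apply mul_le_mul_of_nonneg_left _ hN.le
      linarith
    have h6 : (s₀ + δ ^ 2) * (175 * (s₀ + δ ^ 2) + 16 * δ) ≤ 175 * s₀ ^ 2 + 170 / 10000 := by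
      have h7 : s₀ * δ ^ 2 ≤ 1 * δ ^ 2 := mul_le_mul_of_nonneg_right hs₀' (by positivity)
      have h8 : δ ^ 2 * δ ^ 2 ≤ 1 * δ ^ 2 := mul_le_mul_of_nonneg_right (by linarith) (by positivity)
      have h9 : s₀ * δ ≤ 1 * δ := mul_le_mul_of_nonneg_right hs₀' hδ.le
      have h10 : δ ^ 2 * δ ≤ 1 / 1000000 * δ := mul_le_mul_of_nonneg_right hδ2 hδ.le
      have e1 : (s₀ + δ ^ 2) * (175 * (s₀ + δ ^ 2) + 16 * δ) =
          175 * s₀ ^ 2 + 350 * (s₀ * δ ^ 2) + 175 * (δ ^ 2 * δ ^ 2) + 16 * (s₀ * δ) + 16 * (δ ^ 2 * δ) := by ring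
      rw [e1]
      linarith
    calc _ ≤ (s₀ + δ ^ 2) * (N * (175 * (s₀ + δ ^ 2) + 16 * δ)) := h5
      _ = N * ((s₀ + δ ^ 2) * (175 * (s₀ + δ ^ 2) + 16 * δ)) := by ring
      _ ≤ N * (175 * s₀ ^ 2 + 170 / 10000) := mul_le_mul_of_nonneg_left h6 hN.le
  -- (5) conclude: `|λ| φ2 · 2 s₀² ≤ θ N (175 s₀² + 1/50)/3 ≤ θ · 29.18 N · 2 s₀²`
  have h8 : |lam| * (94253 / 51975) * (2 * s₀ ^ 2) ≤ θ * (2918 / 100) * N * (2 * s₀ ^ 2) := by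
    have h9 : |lam| * (94253 / 51975) * s₀ * (2 * s₀) ≤ θ * (N * (175 * s₀ ^ 2 + 170 / 10000)) / 3 :=
      h3.trans (div_le_div_of_nonneg_right (mul_le_mul_of_nonneg_left hbr hθ) (by norm_num))
    have h10 : N * (175 * s₀ ^ 2 + 170 / 10000) / 3 ≤ (2918 / 100) * N * (2 * s₀ ^ 2) := by
      have hs2 : 49 / 100 ≤ s₀ ^ 2 := by nlinarith only [hs₀]
      have h12 : N * (170 / 10000) ≤ N * (8 / 100 * s₀ ^ 2) := mul_le_mul_of_nonneg_left (by linarith) hN.le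
      have e1 : N * (175 * s₀ ^ 2 + 170 / 10000) / 3 = 175 / 3 * (N * s₀ ^ 2) + N * (170 / 10000) / 3 := by ring
      have e2 : (2918 / 100) * N * (2 * s₀ ^ 2) = 5836 / 100 * (N * s₀ ^ 2) := by ring
      rw [e1, e2]
      have e3 : N * (8 / 100 * s₀ ^ 2) = 8 / 100 * (N * s₀ ^ 2) := by ring
      rw [e3] at h12
      linarith
    calc |lam| * (94253 / 51975) * (2 * s₀ ^ 2) = |lam| * (94253 / 51975) * s₀ * (2 * s₀) := by ring
      _ ≤ θ * (N * (175 * s₀ ^ 2 + 170 / 10000)) / 3 := h9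
      _ = θ * (N * (175 * s₀ ^ 2 + 170 / 10000) / 3) := by ring
      _ ≤ θ * ((2918 / 100) * N * (2 * s₀ ^ 2)) := mul_le_mul_of_nonneg_left h10 hθ
      _ = _ := by ring
  have h2s : 0 < 2 * s₀ ^ 2 := by positivity
  have hB : |lam| * (94253 / 51975) ≤ θ * (2918 / 100) * N := le_of_mul_le_mul_right h8 h2s
  refine ⟨?_, hB⟩
  -- `29.18 / 1.81342… ≤ 16.2`
  have h11 : |lam| * (94253 / 51975) ≤ (θ * (162 / 10) * N) * (94253 / 51975) := by
    have : θ * (2918 / 100) * N ≤ θ * (162 / 10) * N * (94253 / 51975) := by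
      have h0 : 0 ≤ θ * N := by positivity
      nlinarith only [h0]
    exact hB.trans this
  exact le_of_mul_le_mul_right h11 (by norm_num)

/-- **THE TWO INNER TOUCHING CASES.** Data: the pinned window, `Λ ≥ 1000` (`δΛ = 1`), `e^{x_Λ} = 2s₀/Λ`, the digested
tube (`htc`, `htd`), a differentiable real solution `(u₁, u₂)` of the real resolvent system with a `(1 + S)`-weighted source of
size `N`, the primitive `H` of the `V`-source on `x ≤ x_Λ` (`H′ = h₂`, `|H| ≤ 0.7N`, `H(x_Λ) = 0`), the matching constant
`λφ(2) = V(x_Λ)`, barrier parameters `0 < ε ≤ 1/100`, `0 ≤ η ≤ N`, and a number `θ ≥ 0` dominating the inner gauges on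
`x ≤ x_Λ` and the outer ones at `x_Λ`. Conclusion: if `|U| = θŪ` at some `x⋆ ≤ x_Λ`, or `|Z| = θZ̄` at some `x⋆ ≤ x_Λ`,
then `θ ≤ 1`. [folklore] -/
theorem inner_cases (r Λ δ s₀ N ε η θ lam xL : ℝ) (W S u₁ u₂ f₁ f₂ Hf : ℝ → ℝ)
    (hr1 : 17307 / 15625 ≤ r) (hr2 : r ≤ 697 / 625) (hδΛ : δ * Λ = 1) (hδ : 0 < δ) (hδ' : δ ≤ 1 / 1000)
    (hs₀ : 7 / 10 ≤ s₀) (hs₀' : s₀ ≤ 1) (hxL : Real.exp xL = 2 * s₀ / Λ) (hN : 0 < N) (hε : 0 < ε) (hε' : ε ≤ 1 / 100)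
    (hη : 0 ≤ η) (hηN : η ≤ N) (hθ : 0 ≤ θ) (hSpos : ∀ x, 0 < S x) (hSd : Differentiable ℝ S)
    (hu₁ : Differentiable ℝ u₁) (hu₂ : Differentiable ℝ u₂)
    (htc : (∀ x, x ≤ 1 → |W x| ≤ 1 / 4 ∧ 7 / 10 ≤ Real.exp x * S x ∧ Real.exp x * S x ≤ 1))
    (htd : (∀ x, x ≤ 0 → |W x - (r - 1)| ≤ Real.exp x ^ 2 / 10 + 2 * Real.exp x ^ 4 ∧ |deriv W x| ≤ Real.exp x ^ 2 / 5 + 2 * Real.exp x ^ 4 ∧ |Real.exp x * S x - s₀| ≤ Real.exp x ^ 2 / 10 + 2 * Real.exp x ^ 4 ∧ |Real.exp x * (S x + deriv S x)| ≤ Real.exp x ^ 2 / 5 + 2 * Real.exp x ^ 4))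
    (heq : ∀ x, Λ * u₁ x - ((W x - 1) * deriv u₁ x + 3 * S x * deriv u₂ x + (deriv W x + 2 * W x - r) * u₁ x + (3 * deriv S x + 6 * S x) * u₂ x) = f₁ x ∧ Λ * u₂ x - (S x / 3 * deriv u₁ x + (W x - 1) * deriv u₂ x + (deriv S x + 2 * S x) * u₁ x + (deriv W x / 3 + 2 * W x - r) * u₂ x) = f₂ x)
    (hf : ∀ y, |f₁ y| / (1 + S y) + |f₂ y| / S y ≤ N)
    (hHd : ∀ x, x ≤ xL → HasDerivAt Hf (-(Λ * Real.exp x ^ 2 * S x * ((1 - W x) * f₂ x + S x * f₁ x / 3)) / (s₀ ^ 2 * (S x ^ 2 - (1 - W x) ^ 2))) x ∧ |Hf x| ≤ 7 / 10 * N) (hH0 : Hf xL = 0)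
    (hlam : lam * (94253 / 51975) = (Λ * Real.exp xL ^ 2 * S xL * u₂ xL / s₀ ^ 2))
    (hθU : ∀ x, x ≤ xL → |(u₁ x - lam * (1 + (Λ / s₀ * Real.exp x) ^ 2 / 10 + (Λ / s₀ * Real.exp x) ^ 4 / 280 + (Λ / s₀ * Real.exp x) ^ 6 / 15120 + (Λ / s₀ * Real.exp x) ^ 8 / 1330560))| ≤ θ * (9 * N * Real.exp (-(ε * (x - xL)))))
    (hθZ : ∀ x, x ≤ xL → |((Λ * Real.exp x ^ 2 * S x * u₂ x / s₀ ^ 2) - Hf x - lam * (1 + (Λ / s₀ * Real.exp x) ^ 2 / 6 + (Λ / s₀ * Real.exp x) ^ 4 / 120 + (Λ / s₀ * Real.exp x) ^ 6 / 5040 + (Λ / s₀ * Real.exp x) ^ 8 / 362880 + (Λ / s₀ * Real.exp x) ^ 10 / 39916800))| ≤ θ * (17 / 10 * N * (401 / 100 - (Λ / s₀ * Real.exp x) ^ 2) * Real.exp (-(ε * (x - xL)))))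
    (hθPM : |u₁ xL + 3 * u₂ xL| + |u₁ xL - 3 * u₂ xL| ≤ θ * (N / Λ * (4 + 175 * S xL) + 2 * (η * Real.exp xL))) :
    (∀ xs, xs ≤ xL → |(u₁ xs - lam * (1 + (Λ / s₀ * Real.exp xs) ^ 2 / 10 + (Λ / s₀ * Real.exp xs) ^ 4 / 280 + (Λ / s₀ * Real.exp xs) ^ 6 / 15120 + (Λ / s₀ * Real.exp xs) ^ 8 / 1330560))| = θ * (9 * N * Real.exp (-(ε * (xs - xL)))) → θ ≤ 1) ∧
    (∀ xs, xs ≤ xL → |((Λ * Real.exp xs ^ 2 * S xs * u₂ xs / s₀ ^ 2) - Hf xs - lam * (1 + (Λ / s₀ * Real.exp xs) ^ 2 / 6 + (Λ / s₀ * Real.exp xs) ^ 4 / 120 + (Λ / s₀ * Real.exp xs) ^ 6 / 5040 + (Λ / s₀ * Real.exp xs) ^ 8 / 362880 + (Λ / s₀ * Real.exp xs) ^ 10 / 39916800))| = θ * (17 / 10 * N * (401 / 100 - (Λ / s₀ * Real.exp xs) ^ 2) * Real.exp (-(ε * (xs - xL)))) → θ ≤ 1) := by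
  have hΛ : 1000 ≤ Λ := thousand_le_of_delta hδΛ hδ hδ'
  have hΛpos : 0 < Λ := by linarith
  have hs0 : 0 < s₀ := by linarith
  -- the matching constant
  have hlamB : |lam| ≤ θ * (162 / 10) * N := by
    obtain ⟨-, -, heΛ', -, hst1, hst2, hst0, -⟩ := inner_atoms_at hδΛ hδ hδ' hs₀ hs₀' hxL htc htd (le_refl xL)
    have heΛ : Real.exp xL * Λ = 2 * s₀ := by rw [hxL]; field_simp
    refine (packingResolventW_lamBound Λ δ s₀ N η θ (Real.exp xL) (S xL) (u₁ xL + 3 * u₂ xL) (u₁ xL - 3 * u₂ xL) lam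
      hδΛ hδ hδ' hs₀ hs₀' heΛ hst1 hst2 hst0 hN hη hηN hθ hθPM ?_).1
    rw [hlam]; ring
  constructor
  · -- ===== `U` touches at `xs ≤ x_Λ` =====
    intro xs hxs htouch
    obtain ⟨he, he2, -, -, -, -, -, -, -, -, hDd, hρs, hρ0, hρ2⟩ := inner_atoms_at hδΛ hδ hδ' hs₀ hs₀' hxL htc htd hxs
    obtain ⟨hVd, a₁₁, a₁₂, a₂₁, a₂₂, h₁, hnf1, hnf2, b11, b12, b21, b22a, b22b, bh1⟩ :=
      packingResolventW_innerPoint r Λ δ s₀ N xL W S u₁ u₂ f₁ f₂ hr1 hr2 hδΛ hδ hδ' hs₀ hs₀' hxL hSpos hSd hu₂ htc htd hN.le hf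
        xs hxs (heq xs)
    have hef1 : 1 ≤ Real.exp (-(ε * (xs - xL))) := by
      apply Real.one_le_exp
      have : 0 ≤ ε * (xL - xs) := mul_nonneg hε.le (by linarith)
      linarith
    obtain ⟨hΦ1, hΦ2', hΦ3, hΨ1, hΨ2⟩ := besselPhi5_bounds hρ0.le hρ2
    have hΦ2 : (1 + (Λ / s₀ * Real.exp xs) ^ 2 / 6 + (Λ / s₀ * Real.exp xs) ^ 4 / 120 + (Λ / s₀ * Real.exp xs) ^ 6 / 5040 + (Λ / s₀ * Real.exp xs) ^ 8 / 362880 + (Λ / s₀ * Real.exp xs) ^ 10 / 39916800) ≤ 182 / 100 := hΦ2'.trans hΦ3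
    -- derivatives
    have hΨd : HasDerivAt (fun x => (1 + (Λ / s₀ * Real.exp x) ^ 2 / 10 + (Λ / s₀ * Real.exp x) ^ 4 / 280 + (Λ / s₀ * Real.exp x) ^ 6 / 15120 + (Λ / s₀ * Real.exp x) ^ 8 / 1330560))
        (3 * (1 + (Λ / s₀ * Real.exp xs) ^ 2 / 6 + (Λ / s₀ * Real.exp xs) ^ 4 / 120 + (Λ / s₀ * Real.exp xs) ^ 6 / 5040 + (Λ / s₀ * Real.exp xs) ^ 8 / 362880 + (Λ / s₀ * Real.exp xs) ^ 10 / 39916800) - 3 * (1 + (Λ / s₀ * Real.exp xs) ^ 2 / 10 + (Λ / s₀ * Real.exp xs) ^ 4 / 280 + (Λ / s₀ * Real.exp xs) ^ 6 / 15120 + (Λ / s₀ * Real.exp xs) ^ 8 / 1330560) - ((Λ / s₀ * Real.exp xs) ^ 2) ^ 5 / 13305600) xs :=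
      (besselPsi5_comp_hasDerivAt (Λ / s₀) xs).congr_deriv (by ring)
    have hUd : HasDerivAt (fun x => (u₁ x - lam * (1 + (Λ / s₀ * Real.exp x) ^ 2 / 10 + (Λ / s₀ * Real.exp x) ^ 4 / 280 + (Λ / s₀ * Real.exp x) ^ 6 / 15120 + (Λ / s₀ * Real.exp x) ^ 8 / 1330560)))
        (deriv u₁ xs - lam * (3 * (1 + (Λ / s₀ * Real.exp xs) ^ 2 / 6 + (Λ / s₀ * Real.exp xs) ^ 4 / 120 + (Λ / s₀ * Real.exp xs) ^ 6 / 5040 + (Λ / s₀ * Real.exp xs) ^ 8 / 362880 + (Λ / s₀ * Real.exp xs) ^ 10 / 39916800) - 3 * (1 + (Λ / s₀ * Real.exp xs) ^ 2 / 10 + (Λ / s₀ * Real.exp xs) ^ 4 / 280 + (Λ / s₀ * Real.exp xs) ^ 6 / 15120 + (Λ / s₀ * Real.exp xs) ^ 8 / 1330560) - ((Λ / s₀ * Real.exp xs) ^ 2) ^ 5 / 13305600)) xs :=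
      (hu₁ xs).hasDerivAt.sub (hΨd.const_mul lam)
    have hUbd : HasDerivAt (fun x => (9 * N * Real.exp (-(ε * (x - xL))))) (-(ε * (9 * N * Real.exp (-(ε * (xs - xL)))))) xs := by
      have h1 : HasDerivAt (fun x => -(ε * (x - xL))) (-(ε * 1)) xs := (((hasDerivAt_id xs).sub_const xL).const_mul ε).neg
      have h2 := (h1.exp).const_mul (9 * N)
      refine h2.congr_deriv ?_
      ring
    -- the touching inequality
    have hode : (-1 : ℝ) * (deriv u₁ xs - lam * (3 * (1 + (Λ / s₀ * Real.exp xs) ^ 2 / 6 + (Λ / s₀ * Real.exp xs) ^ 4 / 120 + (Λ / s₀ * Real.exp xs) ^ 6 / 5040 + (Λ / s₀ * Real.exp xs) ^ 8 / 362880 + (Λ / s₀ * Real.exp xs) ^ 10 / 39916800) - 3 * (1 + (Λ / s₀ * Real.exp xs) ^ 2 / 10 + (Λ / s₀ * Real.exp xs) ^ 4 / 280 + (Λ / s₀ * Real.exp xs) ^ 6 / 15120 + (Λ / s₀ * Real.exp xs) ^ 8 / 1330560) - ((Λ / s₀ * Real.exp xs) ^ 2) ^ 5 / 13305600)) =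
        (-a₁₁) * (u₁ xs - lam * (1 + (Λ / s₀ * Real.exp xs) ^ 2 / 10 + (Λ / s₀ * Real.exp xs) ^ 4 / 280 + (Λ / s₀ * Real.exp xs) ^ 6 / 15120 + (Λ / s₀ * Real.exp xs) ^ 8 / 1330560)) - ((-a₁₁) * (u₁ xs - lam * (1 + (Λ / s₀ * Real.exp xs) ^ 2 / 10 + (Λ / s₀ * Real.exp xs) ^ 4 / 280 + (Λ / s₀ * Real.exp xs) ^ 6 / 15120 + (Λ / s₀ * Real.exp xs) ^ 8 / 1330560)) - (-1) * (deriv u₁ xs - lam * (3 * (1 + (Λ / s₀ * Real.exp xs) ^ 2 / 6 + (Λ / s₀ * Real.exp xs) ^ 4 / 120 + (Λ / s₀ * Real.exp xs) ^ 6 / 5040 + (Λ / s₀ * Real.exp xs) ^ 8 / 362880 + (Λ / s₀ * Real.exp xs) ^ 10 / 39916800) - 3 * (1 + (Λ / s₀ * Real.exp xs) ^ 2 / 10 + (Λ / s₀ * Real.exp xs) ^ 4 / 280 + (Λ / s₀ * Real.exp xs) ^ 6 / 15120 + (Λ / s₀ * Real.exp xs) ^ 8 / 1330560) - ((Λ /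 s₀ * Real.exp xs) ^ 2) ^ 5 / 13305600))) := by
      ring
    have hT := Literature.Analysis.ODE.barrier_touching' (x₁ := xs - 1) (x₂ := xL) (xs := xs) (θ := θ)
      (c := fun _ => (-1 : ℝ)) (β := fun _ => -a₁₁)
      (h := fun _ => (-a₁₁) * (u₁ xs - lam * (1 + (Λ / s₀ * Real.exp xs) ^ 2 / 10 + (Λ / s₀ * Real.exp xs) ^ 4 / 280 + (Λ / s₀ * Real.exp xs) ^ 6 / 15120 + (Λ / s₀ * Real.exp xs) ^ 8 / 1330560)) - (-1) * (deriv u₁ xs - lam * (3 * (1 + (Λ / s₀ * Real.exp xs) ^ 2 / 6 + (Λ / s₀ * Real.exp xs) ^ 4 / 120 + (Λ / s₀ * Real.exp xs) ^ 6 / 5040 + (Λ / s₀ * Real.exp xs) ^ 8 / 362880 + (Λ / s₀ * Real.exp xs) ^ 10 / 39916800) - 3 * (1 + (Λ / s₀ * Real.exp xs) ^ 2 / 10 + (Λ / s₀ * Real.exp xs) ^ 4 / 280 + (Λ / s₀ * Real.exp xs) ^ 6 / 15120 + (Λ / s₀ * Real.exp xs) ^ 8 / 1330560) - ((Λ / s₀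 * Real.exp xs) ^ 2) ^ 5 / 13305600)))
      (y := fun x => (u₁ x - lam * (1 + (Λ / s₀ * Real.exp x) ^ 2 / 10 + (Λ / s₀ * Real.exp x) ^ 4 / 280 + (Λ / s₀ * Real.exp x) ^ 6 / 15120 + (Λ / s₀ * Real.exp x) ^ 8 / 1330560)))
      (y' := fun _ => deriv u₁ xs - lam * (3 * (1 + (Λ / s₀ * Real.exp xs) ^ 2 / 6 + (Λ / s₀ * Real.exp xs) ^ 4 / 120 + (Λ / s₀ * Real.exp xs) ^ 6 / 5040 + (Λ / s₀ * Real.exp xs) ^ 8 / 362880 + (Λ / s₀ * Real.exp xs) ^ 10 / 39916800) - 3 * (1 + (Λ / s₀ * Real.exp xs) ^ 2 / 10 + (Λ / s₀ * Real.exp xs) ^ 4 / 280 + (Λ / s₀ * Real.exp xs) ^ 6 / 15120 + (Λ / s₀ * Real.exp xs) ^ 8 / 1330560) - ((Λ / s₀ * Real.exp xs) ^ 2) ^ 5 / 13305600))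
      (yb := fun x => (9 * N * Real.exp (-(ε * (x - xL))))) (yb' := fun _ => -(ε * (9 * N * Real.exp (-(ε * (xs - xL))))))
      ⟨by linarith, hxs⟩ hUd hUbd (fun x _ => by positivity) (fun x hx => hθU x hx.2) htouch hode
      (fun h => by linarith) (fun _ => by norm_num)
    -- close with the arithmetic
    have hVZ : (Λ * Real.exp xs ^ 2 * S xs * u₂ xs / s₀ ^ 2) = ((Λ * Real.exp xs ^ 2 * S xs * u₂ xs / s₀ ^ 2) - Hf xs - lam * (1 + (Λ / s₀ * Real.exp xs) ^ 2 / 6 + (Λ / s₀ * Real.exp xs) ^ 4 / 120 + (Λ / s₀ * Real.exp xs) ^ 6 / 5040 + (Λ / s₀ * Real.exp xs) ^ 8 / 362880 + (Λ / s₀ * Real.exp xs) ^ 10 / 39916800)) + Hf xs + lam * (1 + (Λ / s₀ * Real.exp xs) ^ 2 / 6 + (Λ / s₀ * Real.exp xs) ^ 4 / 120 + (Λ / s₀ * Real.exp xs) ^ 6 / 5040 + (Λ / s₀ * Real.exp xs) ^ 8 / 362880 + (Λ / s₀ * Real.exp xs) ^ 10 / 39916800) := by ring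
    have hρ4 : (Λ / s₀ * Real.exp xs) ^ 2 ≤ 4 := by
      calc (Λ / s₀ * Real.exp xs) ^ 2 ≤ (2:ℝ) ^ 2 := pow_le_pow_left₀ hρ0.le hρ2 2
        _ = 4 := by norm_num
    exact inner_U_touch (ε := ε) hθ hN hδ hδ' hε' hef1 (sq_nonneg _) hρ4 b11 b12 bh1 hΦ1 hΦ2 hΨ1 hΨ2
      (hθZ xs hxs) (hHd xs hxs).2 hlamB hnf1 hVZ hT
  · -- ===== `Z` touches at `xs ≤ x_Λ` =====
    intro xs hxs htouch
    rcases eq_or_lt_of_le hxs with hxe | hlt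
    · -- at the interface `Z(x_Λ) = 0`, so `θ Z̄(x_Λ) = 0`
      subst hxe
      have hρL : Λ / s₀ * Real.exp xs = 2 := by rw [hxL]; field_simp
      have hZ0 : ((Λ * Real.exp xs ^ 2 * S xs * u₂ xs / s₀ ^ 2) - Hf xs - lam * (1 + (Λ / s₀ * Real.exp xs) ^ 2 / 6 + (Λ / s₀ * Real.exp xs) ^ 4 / 120 + (Λ / s₀ * Real.exp xs) ^ 6 / 5040 + (Λ / s₀ * Real.exp xs) ^ 8 / 362880 + (Λ / s₀ * Real.exp xs) ^ 10 / 39916800)) = 0 := by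
        rw [hH0, hρL, ← hlam]
        have : (1 + (2:ℝ) ^ 2 / 6 + (2:ℝ) ^ 4 / 120 + (2:ℝ) ^ 6 / 5040 + (2:ℝ) ^ 8 / 362880 + (2:ℝ) ^ 10 / 39916800) = 94253 / 51975 := bessel_values_two.1
        rw [this]; ring
      rw [hZ0, abs_zero, hρL] at htouch
      have hpos : 0 < 17 / 10 * N * (401 / 100 - (2:ℝ) ^ 2) * Real.exp (-(ε * (xs - xs))) := by
        rw [sub_self, mul_zero, neg_zero, Real.exp_zero]; norm_num; exact hN
      by_contra hne
      push Not at hne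
      have hθpos : 0 < θ := by linarith
      have := mul_pos hθpos hpos
      linarith
    · obtain ⟨he, he2, -, -, -, -, -, -, -, -, hDd, hρs, hρ0, hρ2⟩ := inner_atoms_at hδΛ hδ hδ' hs₀ hs₀' hxL htc htd hxs
      obtain ⟨hVd, a₁₁, a₁₂, a₂₁, a₂₂, h₁, hnf1, hnf2, b11, b12, b21, b22a, b22b, bh1⟩ :=
        packingResolventW_innerPoint r Λ δ s₀ N xL W S u₁ u₂ f₁ f₂ hr1 hr2 hδΛ hδ hδ' hs₀ hs₀' hxL hSpos hSd hu₂ htc htd hN.le hf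
          xs hxs (heq xs)
      have hef1 : 1 ≤ Real.exp (-(ε * (xs - xL))) := by
        apply Real.one_le_exp
        have : 0 ≤ ε * (xL - xs) := mul_nonneg hε.le (by linarith)
        linarith
      obtain ⟨hΦ1, hΦ2', hΦ3, hΨ1, hΨ2⟩ := besselPhi5_bounds hρ0.le hρ2
      have hΦ2 : (1 + (Λ / s₀ * Real.exp xs) ^ 2 / 6 + (Λ / s₀ * Real.exp xs) ^ 4 / 120 + (Λ / s₀ * Real.exp xs) ^ 6 / 5040 + (Λ / s₀ * Real.exp xs) ^ 8 / 362880 + (Λ / s₀ * Real.exp xs) ^ 10 / 39916800) ≤ 182 / 100 := hΦ2'.trans hΦ3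
      -- derivatives
      have hΦd : HasDerivAt (fun x => (1 + (Λ / s₀ * Real.exp x) ^ 2 / 6 + (Λ / s₀ * Real.exp x) ^ 4 / 120 + (Λ / s₀ * Real.exp x) ^ 6 / 5040 + (Λ / s₀ * Real.exp x) ^ 8 / 362880 + (Λ / s₀ * Real.exp x) ^ 10 / 39916800)) ((Λ / s₀ * Real.exp xs) ^ 2 / 3 * (1 + (Λ / s₀ * Real.exp xs) ^ 2 / 10 + (Λ / s₀ * Real.exp xs) ^ 4 / 280 + (Λ / s₀ * Real.exp xs) ^ 6 / 15120 + (Λ / s₀ * Real.exp xs) ^ 8 / 1330560)) xs :=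
        besselPhi5_comp_hasDerivAt (Λ / s₀) xs
      have hZd : HasDerivAt (fun x => ((Λ * Real.exp x ^ 2 * S x * u₂ x / s₀ ^ 2) - Hf x - lam * (1 + (Λ / s₀ * Real.exp x) ^ 2 / 6 + (Λ / s₀ * Real.exp x) ^ 4 / 120 + (Λ / s₀ * Real.exp x) ^ 6 / 5040 + (Λ / s₀ * Real.exp x) ^ 8 / 362880 + (Λ / s₀ * Real.exp x) ^ 10 / 39916800)))
          ((Λ * (2 * Real.exp xs ^ 2 * S xs * u₂ xs + Real.exp xs ^ 2 * deriv S xs * u₂ xs + Real.exp xs ^ 2 * S xs * deriv u₂ xs) / s₀ ^ 2) - (-(Λ * Real.exp xs ^ 2 * S xs * ((1 - W xs) * f₂ xs + S xs * f₁ xs / 3)) / (s₀ ^ 2 * (S xs ^ 2 - (1 - W xs) ^ 2))) - lam * ((Λ / s₀ * Real.exp xs) ^ 2 / 3 * (1 + (Λ / s₀ * Real.exp xs) ^ 2 / 10 + (Λ / s₀ * Real.exp xs) ^ 4 / 280 + (Λ / s₀ * Real.exp xs) ^ 6 / 15120 + (Λ / s₀ * Real.exp xs) ^ 8 / 1330560)))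 xs :=
        (hVd.sub (hHd xs hxs).1).sub (hΦd.const_mul lam)
      have hZbd : HasDerivAt (fun x => (17 / 10 * N * (401 / 100 - (Λ / s₀ * Real.exp x) ^ 2) * Real.exp (-(ε * (x - xL)))))
          (17 / 10 * N * (-(2 * (Λ / s₀ * Real.exp xs) ^ 2) - ε * (401 / 100 - (Λ / s₀ * Real.exp xs) ^ 2)) * Real.exp (-(ε * (xs - xL)))) xs := by
        have h1 : HasDerivAt (fun x => -(ε * (x - xL))) (-(ε * 1)) xs := (((hasDerivAt_id xs).sub_const xL).const_mul ε).neg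
        have h2a : HasDerivAt (fun x => (Λ / s₀ * Real.exp x) ^ 2) (2 * (Λ / s₀ * Real.exp xs) * (Λ / s₀ * Real.exp xs)) xs := by
          simpa using ((Real.hasDerivAt_exp xs).const_mul (Λ / s₀)).fun_pow 2
        have h2 : HasDerivAt (fun x => 401 / 100 - (Λ / s₀ * Real.exp x) ^ 2) (0 - 2 * (Λ / s₀ * Real.exp xs) * (Λ / s₀ * Real.exp xs)) xs :=
          (hasDerivAt_const xs _).sub h2a
        have h3 := (h2.const_mul (17 / 10 * N)).mul h1.exp
        refine h3.congr_deriv ?_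
        ring
      have hode : (1 : ℝ) * ((Λ * (2 * Real.exp xs ^ 2 * S xs * u₂ xs + Real.exp xs ^ 2 * deriv S xs * u₂ xs + Real.exp xs ^ 2 * S xs * deriv u₂ xs) / s₀ ^ 2) - (-(Λ * Real.exp xs ^ 2 * S xs * ((1 - W xs) * f₂ xs + S xs * f₁ xs / 3)) / (s₀ ^ 2 * (S xs ^ 2 - (1 - W xs) ^ 2))) - lam * ((Λ / s₀ * Real.exp xs) ^ 2 / 3 * (1 + (Λ / s₀ * Real.exp xs) ^ 2 / 10 + (Λ / s₀ * Real.exp xs) ^ 4 / 280 + (Λ / s₀ * Real.exp xs) ^ 6 / 15120 + (Λ / s₀ * Real.exp xs) ^ 8 / 1330560))) =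
          a₂₂ * ((Λ * Real.exp xs ^ 2 * S xs * u₂ xs / s₀ ^ 2) - Hf xs - lam * (1 + (Λ / s₀ * Real.exp xs) ^ 2 / 6 + (Λ / s₀ * Real.exp xs) ^ 4 / 120 + (Λ / s₀ * Real.exp xs) ^ 6 / 5040 + (Λ / s₀ * Real.exp xs) ^ 8 / 362880 + (Λ / s₀ * Real.exp xs) ^ 10 / 39916800)) - (a₂₂ * ((Λ * Real.exp xs ^ 2 * S xs * u₂ xs / s₀ ^ 2) - Hf xs - lam * (1 + (Λ / s₀ * Real.exp xs) ^ 2 / 6 + (Λ / s₀ * Real.exp xs) ^ 4 / 120 + (Λ / s₀ * Real.exp xs) ^ 6 / 5040 + (Λ / s₀ * Real.exp xs) ^ 8 / 362880 + (Λ / s₀ * Real.exp xs) ^ 10 / 39916800)) - 1 * ((Λ * (2 * Real.exp xs ^ 2 * S xs * u₂ xs + Real.exp xs ^ 2 * deriv S xs * u₂ xs + Real.exp xs ^ 2 * S xs * deriv u₂ xs) / s₀ ^ 2) - (-(Λ * Real.exp xs ^ 2 * S xs * ((1 - W xs) * f₂ xs + S xs * f₁ xs / 3)) / (s₀ ^ 2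 * (S xs ^ 2 - (1 - W xs) ^ 2))) - lam * ((Λ / s₀ * Real.exp xs) ^ 2 / 3 * (1 + (Λ / s₀ * Real.exp xs) ^ 2 / 10 + (Λ / s₀ * Real.exp xs) ^ 4 / 280 + (Λ / s₀ * Real.exp xs) ^ 6 / 15120 + (Λ / s₀ * Real.exp xs) ^ 8 / 1330560)))) := by ring
      have hT := Literature.Analysis.ODE.barrier_touching' (x₁ := xs - 1) (x₂ := xL) (xs := xs) (θ := θ)
        (c := fun _ => (1 : ℝ)) (β := fun _ => a₂₂)
        (h := fun _ => a₂₂ * ((Λ * Real.exp xs ^ 2 * S xs * u₂ xs / s₀ ^ 2) - Hf xs - lam * (1 + (Λ / s₀ * Real.exp xs) ^ 2 / 6 + (Λ / s₀ * Real.exp xs) ^ 4 / 120 + (Λ / s₀ * Real.exp xs) ^ 6 / 5040 + (Λ / s₀ * Real.exp xs) ^ 8 / 362880 + (Λ / s₀ * Real.exp xs) ^ 10 / 39916800)) - 1 * ((Λ * (2 * Real.exp xs ^ 2 * S xs * u₂ xs + Real.exp xs ^ 2 * deriv S xs * u₂ xs + Real.exp xs ^ 2 * S xs * deriv u₂ xs)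 / s₀ ^ 2) - (-(Λ * Real.exp xs ^ 2 * S xs * ((1 - W xs) * f₂ xs + S xs * f₁ xs / 3)) / (s₀ ^ 2 * (S xs ^ 2 - (1 - W xs) ^ 2))) - lam * ((Λ / s₀ * Real.exp xs) ^ 2 / 3 * (1 + (Λ / s₀ * Real.exp xs) ^ 2 / 10 + (Λ / s₀ * Real.exp xs) ^ 4 / 280 + (Λ / s₀ * Real.exp xs) ^ 6 / 15120 + (Λ / s₀ * Real.exp xs) ^ 8 / 1330560))))
        (y := fun x => ((Λ * Real.exp x ^ 2 * S x * u₂ x / s₀ ^ 2) - Hf x - lam * (1 + (Λ / s₀ * Real.exp x) ^ 2 / 6 + (Λ / s₀ * Real.exp x) ^ 4 / 120 + (Λ / s₀ * Real.exp x) ^ 6 / 5040 + (Λ / s₀ * Real.exp x) ^ 8 / 362880 + (Λ / s₀ * Real.exp x) ^ 10 / 39916800)))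
        (y' := fun _ => (Λ * (2 * Real.exp xs ^ 2 * S xs * u₂ xs + Real.exp xs ^ 2 * deriv S xs * u₂ xs + Real.exp xs ^ 2 * S xs * deriv u₂ xs) / s₀ ^ 2) - (-(Λ * Real.exp xs ^ 2 * S xs * ((1 - W xs) * f₂ xs + S xs * f₁ xs / 3)) / (s₀ ^ 2 * (S xs ^ 2 - (1 - W xs) ^ 2))) - lam * ((Λ / s₀ * Real.exp xs) ^ 2 / 3 * (1 + (Λ / s₀ * Real.exp xs) ^ 2 / 10 + (Λ / s₀ * Real.exp xs) ^ 4 / 280 + (Λ / s₀ * Real.exp xs) ^ 6 / 15120 + (Λ / s₀ * Real.exp xs) ^ 8 / 1330560)))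
        (yb := fun x => (17 / 10 * N * (401 / 100 - (Λ / s₀ * Real.exp x) ^ 2) * Real.exp (-(ε * (x - xL)))))
        (yb' := fun _ => 17 / 10 * N * (-(2 * (Λ / s₀ * Real.exp xs) ^ 2) - ε * (401 / 100 - (Λ / s₀ * Real.exp xs) ^ 2)) * Real.exp (-(ε * (xs - xL))))
        ⟨by linarith, hxs⟩ hZd hZbd (fun x hx => ?_) (fun x hx => hθZ x hx.2) htouch hode
        (fun h => by linarith) (fun h => absurd h (ne_of_lt hlt))
      · have hu : u₁ xs = (u₁ xs - lam * (1 + (Λ / s₀ * Real.exp xs) ^ 2 / 10 + (Λ / s₀ * Real.exp xs) ^ 4 / 280 + (Λ / s₀ * Real.exp xs) ^ 6 / 15120 + (Λ / s₀ * Real.exp xs) ^ 8 / 1330560)) + lam * (1 + (Λ / s₀ * Real.exp xs) ^ 2 / 10 + (Λ / s₀ * Real.exp xs) ^ 4 / 280 + (Λ / s₀ * Real.exp xs) ^ 6 / 15120 + (Λ / s₀ * Real.exp xs) ^ 8 / 1330560) := by ring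
        have hVZ : (Λ * Real.exp xs ^ 2 * S xs * u₂ xs / s₀ ^ 2) = ((Λ * Real.exp xs ^ 2 * S xs * u₂ xs / s₀ ^ 2) - Hf xs - lam * (1 + (Λ / s₀ * Real.exp xs) ^ 2 / 6 + (Λ / s₀ * Real.exp xs) ^ 4 / 120 + (Λ / s₀ * Real.exp xs) ^ 6 / 5040 + (Λ / s₀ * Real.exp xs) ^ 8 / 362880 + (Λ / s₀ * Real.exp xs) ^ 10 / 39916800)) + Hf xs + lam * (1 + (Λ / s₀ * Real.exp xs) ^ 2 / 6 + (Λ / s₀ * Real.exp xs) ^ 4 / 120 + (Λ / s₀ * Real.exp xs) ^ 6 / 5040 + (Λ / s₀ * Real.exp xs) ^ 8 / 362880 + (Λ / s₀ * Real.exp xs) ^ 10 / 39916800) := by ring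
        have hZ' : (Λ * (2 * Real.exp xs ^ 2 * S xs * u₂ xs + Real.exp xs ^ 2 * deriv S xs * u₂ xs + Real.exp xs ^ 2 * S xs * deriv u₂ xs) / s₀ ^ 2) - (-(Λ * Real.exp xs ^ 2 * S xs * ((1 - W xs) * f₂ xs + S xs * f₁ xs / 3)) / (s₀ ^ 2 * (S xs ^ 2 - (1 - W xs) ^ 2))) - lam * ((Λ / s₀ * Real.exp xs) ^ 2 / 3 * (1 + (Λ / s₀ * Real.exp xs) ^ 2 / 10 + (Λ / s₀ * Real.exp xs) ^ 4 / 280 + (Λ / s₀ * Real.exp xs) ^ 6 / 15120 + (Λ / s₀ * Real.exp xs) ^ 8 / 1330560)) =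
            a₂₁ * u₁ xs + a₂₂ * (Λ * Real.exp xs ^ 2 * S xs * u₂ xs / s₀ ^ 2) - lam * ((Λ / s₀ * Real.exp xs) ^ 2 / 3 * (1 + (Λ / s₀ * Real.exp xs) ^ 2 / 10 + (Λ / s₀ * Real.exp xs) ^ 4 / 280 + (Λ / s₀ * Real.exp xs) ^ 6 / 15120 + (Λ / s₀ * Real.exp xs) ^ 8 / 1330560)) := by rw [hnf2]; ring
        have hρ4 : (Λ / s₀ * Real.exp xs) ^ 2 ≤ 4 := by
          calc (Λ / s₀ * Real.exp xs) ^ 2 ≤ (2:ℝ) ^ 2 := pow_le_pow_left₀ hρ0.le hρ2 2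
            _ = 4 := by norm_num
        exact inner_Z_touch (ε := ε) hθ hN hδ hδ' hε hef1 (by positivity) hρ4 b21 b22a b22b hΦ1 hΦ2 hΨ1 hΨ2
          (hθU xs hxs) (hHd xs hxs).2 hlamB hu hVZ hZ' hT
      · -- positivity of `Z̄` on `[xs − 1, x_Λ]`: `ρ ≤ 2` there
        obtain ⟨-, -, -, -, -, -, -, -, -, -, -, -, -, hx2⟩ := inner_atoms_at hδΛ hδ hδ' hs₀ hs₀' hxL htc htd hx.2
        have hx0 : 0 ≤ Λ / s₀ * Real.exp x := by positivity
        have hx4 : (Λ / s₀ * Real.exp x) ^ 2 ≤ 4 := by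
          calc (Λ / s₀ * Real.exp x) ^ 2 ≤ (2:ℝ) ^ 2 := pow_le_pow_left₀ hx0 hx2 2
            _ = 4 := by norm_num
        have : 0 < 401 / 100 - (Λ / s₀ * Real.exp x) ^ 2 := by linarith
        positivity

end Summit.AtomisticToContinuum.HydrodynamicLimit.Theorems.PackingAnalyticImplosion

end
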